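import Mathlib
import Literature.Analysis.FluidPDE.TypeIAncientMild
import Literature.Analysis.FluidPDE.HyperbolicDSSOrbit
import Literature.Analysis.FluidPDE.AncientSimilarityVariables
import Literature.Analysis.FluidPDE.AncientSimilarityVorticity
import Literature.Analysis.FluidPDE.VorticityCalculus
import Literature.Analysis.FluidPDE.RadialSmoothCutoff
import Literature.Analysis.FluidPDE.NullLagrangianDeterminant
import Literature.Analysis.FluidPDE.LerayGaugeStrainSpectrum
import Literature.Analysis.FluidPDE.WholeSpaceIBP
import Summits.NavierStokesRegularity.NavierStokesRegularity.Theorems.SqueezeCycleMustSqueezeAlgebra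

/-!
# drefute gen-2 evidence — the STATIC half of the lever `stub_signedBudget`
  (line `outward-drift-signed-flux`, crux `MustSqueeze`, stmt-NavierStokesRegularity-11610)

Everything in the lever that does not involve the time derivative, certified:

* `trace_fderiv_lerayOrbit_eq_zero`, `strainEigenvalues_fderiv_lerayOrbit_le` — the dictionary
  `div U = 0`, `λ₂(sym DU(s,y)) ≤ a` from `div u = 0` and `lerayMiddleStrain u ≤ a`
  (Courant–Fischer both ways, no eigenvalue-scaling lemma);
* `production_pointwise` — `⟪DU Ω, Ω⟫ ≤ 4 det DU + a (2‖DU‖²_F − ‖Ω‖²)` at every `(s, y)`;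
* flux bounds against the cutoff `φ_R = smoothTransition (2 − ‖y‖²/R²)`, `R ≥ 1`:
  cubic `|∫ φ_R det DU| ≤ ½ C c₁ E(2R)/R`, transport `|∫ (U·∇φ_R)‖Ω‖²| ≤ 2 C c₁ E(2R)/R`,
  viscous `|∫ ‖Ω‖² Δφ_R| ≤ 2 c₂ E(2R)/R`, drift `∫ (y·∇φ_R)‖Ω‖² ≤ 0`;
* `lever_static_bound` — the assembled inequality: with `K s := κ₀ E(2R,s)/R + 4aκ'⁺ √(E(2R,s)/R)`
  (continuous, `≥ 0`, `≤ κ (E/R + √(E/R))`),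
  `−½Z + ½∫(y·∇φ)‖Ω‖² + ∫(U·∇φ)‖Ω‖² + 2∫φ⟪DUΩ,Ω⟫ + ∫‖Ω‖²Δφ ≤ −2(¼ − a) Z + K`,
  whose left side is exactly `Z' + 2∫φ‖∇Ω‖²_F` once the lead differentiates `Z` and inserts the
  similarity vorticity equation with the three `WholeSpaceIBPEnstrophy` identities.

No new definitions; `Z`, `E`, `φ_R` are written inline exactly as in the skeleton.
-/

noncomputable section

open MeasureTheory Set Filter Real Metric
open scoped ContDiff RealInnerProductSpace Laplacian
open Literature.Analysis.FluidPDE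

namespace DrefuteG2

local notation "ℝ³" => EuclideanSpace ℝ (Fin 3)

variable {C a : ℝ} {u : ℝ → ℝ³ → ℝ³}

/-! ## Regularity of the orbit (as in gen-1's StubBitsV3) -/

/-- Slices of the similarity orbit of a class element are smooth. -/
theorem contDiff_lerayOrbit_slice (hu : IsTypeIAncientMild C u) (s : ℝ) {n : ℕ∞} :
    ContDiff ℝ n (lerayOrbit u s) := by
  have h : ContDiff ℝ n (Function.uncurry (lerayOrbit u)) :=
    contDiff_uncurry_lerayOrbit (hu.1.of_le (by exact_mod_cast le_top))
  exact h.comp (contDiff_prodMk_right s)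

/-- The Frobenius gradient density of a slice is continuous. -/
theorem continuous_frobeniusNormSq_fderiv_lerayOrbit (hu : IsTypeIAncientMild C u) (s : ℝ) :
    Continuous fun y => frobeniusNormSq (fderiv ℝ (lerayOrbit u s) y) := by
  have hc : Continuous (fderiv ℝ (lerayOrbit u s)) :=
    (contDiff_lerayOrbit_slice hu s (n := 1)).continuous_fderiv one_ne_zero
  unfold frobeniusNormSq
  exact continuous_finsetSum _ fun i _ => ((hc.clm_apply continuous_const).norm).pow 2

/-- The vorticity of a slice is continuous. -/
theorem continuous_lerayVorticity (hu : IsTypeIAncientMild C u) (s : ℝ) :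
    Continuous (lerayVorticity u s) := by
  rw [lerayVorticity_apply]
  exact continuous_curl (contDiff_lerayOrbit_slice hu s (n := 1))

/-- Integrability of the Frobenius density on balls. -/
theorem integrableOn_frobeniusNormSq_ball (hu : IsTypeIAncientMild C u) (s ρ : ℝ) :
    IntegrableOn (fun y => frobeniusNormSq (fderiv ℝ (lerayOrbit u s) y)) (ball (0 : ℝ³) ρ) :=
  (((continuous_frobeniusNormSq_fderiv_lerayOrbit hu s).continuousOn).integrableOn_compact
    (isCompact_closedBall (0 : ℝ³) ρ)).mono_set ball_subset_closedBall

/-- `B_ρ` and its closure agree up to a null set (the sphere is Lebesgue-null). -/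
theorem ball_ae_eq_closedBall' (ρ : ℝ) :
    (ball (0 : ℝ³) ρ : Set ℝ³) =ᵐ[volume] (closedBall (0 : ℝ³) ρ : Set ℝ³) := by
  rw [← ball_union_sphere]
  exact (union_ae_eq_left_of_ae_eq_empty (ae_eq_empty.2 (Measure.addHaar_sphere volume _ _))).symm

/-- `0 ≤ E(ρ, s)`. -/
theorem ballGradEnergy_nonneg (u : ℝ → ℝ³ → ℝ³) (ρ s : ℝ) :
    0 ≤ ∫ y in ball (0 : ℝ³) ρ, frobeniusNormSq (fderiv ℝ (lerayOrbit u s) y) :=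
  setIntegral_nonneg measurableSet_ball fun _ _ => frobeniusNormSq_nonneg _

/-! ## The dictionary: trace-free gradient, middle eigenvalue of the orbit -/

/-- `tr DU(s, y) = 0` (the orbit is divergence free). -/
theorem trace_fderiv_lerayOrbit_eq_zero (hu : IsTypeIAncientMild C u) (s : ℝ) (y : ℝ³) :
    LinearMap.trace ℝ ℝ³ (fderiv ℝ (lerayOrbit u s) y : ℝ³ →ₗ[ℝ] ℝ³) = 0 := by
  have ht : -Real.exp (-s) < (0 : ℝ) := neg_neg_of_pos (Real.exp_pos _)
  exact (isDivFree_lerayOrbit_iff u s).2 (hu.isDivFree ht) y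

/-- **`λ₂(sym DU(s,y)) ≤ a`** from `lerayMiddleStrain u ≤ a` (Courant–Fischer both ways:
`DU(s,y) = e^{-s} • Du(t,x)` and `e^{-s} = -t`). -/
theorem strainEigenvalues_fderiv_lerayOrbit_le (hΛ : ∀ t < 0, ∀ x, lerayMiddleStrain u t x ≤ a)
    (s : ℝ) (y : ℝ³) :
    strainEigenvalues (fderiv ℝ (lerayOrbit u s) y : ℝ³ →ₗ[ℝ] ℝ³) finrank_euclideanSpace_fin 1 ≤ a := by
  have ht : -Real.exp (-s) < (0 : ℝ) := neg_neg_of_pos (Real.exp_pos _)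
  obtain ⟨v, w, hv, hw, hvw, h⟩ :=
    (lerayMiddleStrain_le_iff ht a).1 (hΛ _ ht (Real.exp (-s / 2) • y))
  refine (strainEigenvalues_mid_le_iff _ finrank_euclideanSpace_fin a).2 ⟨v, w, hv, hw, hvw, fun α β => ?_⟩
  have key := h α β
  rw [neg_neg] at key
  rw [ContinuousLinearMap.coe_coe, fderiv_lerayOrbit, FunLike.coe_smul, Pi.smul_apply,
    real_inner_smul_left]
  exact key

/-- **Pointwise production bound on the orbit**:
`⟪DU Ω, Ω⟫ ≤ 4 det DU + a (2 ‖DU‖²_F − ‖Ω‖²)` (`inner_fderiv_curl_le` with the dictionary, and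
`tr(DU ∘ DU) = ‖DU‖²_F − ‖Ω‖²`). -/
theorem production_pointwise (hu : IsTypeIAncientMild C u)
    (hΛ : ∀ t < 0, ∀ x, lerayMiddleStrain u t x ≤ a) (ha : 0 ≤ a) (s : ℝ) (y : ℝ³) :
    ⟪fderiv ℝ (lerayOrbit u s) y (lerayVorticity u s y), lerayVorticity u s y⟫ ≤
      4 * LinearMap.det (fderiv ℝ (lerayOrbit u s) y : ℝ³ →ₗ[ℝ] ℝ³) +
        a * (2 * frobeniusNormSq (fderiv ℝ (lerayOrbit u s) y) - ‖lerayVorticity u s y‖ ^ 2) := by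
  have key := Summit.NavierStokesRegularity.NavierStokesRegularity.Theorems.inner_fderiv_curl_le
    (v := lerayOrbit u s) (y := y) ha (trace_fderiv_lerayOrbit_eq_zero hu s y)
    (strainEigenvalues_fderiv_lerayOrbit_le hΛ s y)
  have hcurl := Summit.NavierStokesRegularity.NavierStokesRegularity.Theorems.norm_curl_sq_eq_frobeniusNormSq_sub_trace
    (lerayOrbit u s) y
  rw [lerayVorticity_apply]
  have e : frobeniusNormSq (fderiv ℝ (lerayOrbit u s) y) +
      LinearMap.trace ℝ ℝ³ ((fderiv ℝ (lerayOrbit u s) y : ℝ³ →ₗ[ℝ] ℝ³) ∘ₗ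
        (fderiv ℝ (lerayOrbit u s) y : ℝ³ →ₗ[ℝ] ℝ³)) =
      2 * frobeniusNormSq (fderiv ℝ (lerayOrbit u s) y) - ‖curl (lerayOrbit u s) y‖ ^ 2 := by
    linarith
  rw [← e]
  exact key

/-! ## The cutoff `φ_R` -/

/-- The cutoff vanishes identically near every point outside `closedBall 0 (2R)`. -/
theorem tsupport_cutoff_subset {R : ℝ} (hR : 0 < R) :
    tsupport (fun y : ℝ³ => smoothTransition (2 - ‖y‖ ^ 2 / R ^ 2)) ⊆ closedBall (0 : ℝ³) (2 * R) := by
  refine closure_minimal (fun y hy => ?_) isClosed_closedBall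
  by_contra h
  exact hy (smoothTransition_cutoff_eq_zero_of_notMem hR h)

/-- Off `closedBall 0 (2R)` the gradient of the cutoff vanishes. -/
theorem fderiv_cutoff_eq_zero {R : ℝ} (hR : 0 < R) {y : ℝ³} (hy : y ∉ closedBall (0 : ℝ³) (2 * R)) :
    fderiv ℝ (fun z : ℝ³ => smoothTransition (2 - ‖z‖ ^ 2 / R ^ 2)) y = 0 :=
  fderiv_of_notMem_tsupport ℝ fun h => hy (tsupport_cutoff_subset hR h)

/-- Off `closedBall 0 (2R)` the Laplacian of the cutoff vanishes. -/
theorem laplacian_cutoff_eq_zero {R : ℝ} (hR : 0 < R) {y : ℝ³} (hy : y ∉ closedBall (0 : ℝ³) (2 * R)) :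
    (Δ (fun z : ℝ³ => smoothTransition (2 - ‖z‖ ^ 2 / R ^ 2))) y = 0 :=
  laplacian_eq_zero_of_notMem_tsupport fun h => hy (tsupport_cutoff_subset hR h)

/-- `‖∇φ‖ = ‖Dφ‖`. -/
theorem norm_gradient_eq (φ : ℝ³ → ℝ) (y : ℝ³) : ‖gradient φ y‖ = ‖fderiv ℝ φ y‖ := by
  rw [gradient, LinearIsometryEquiv.norm_map]


/-- Pointwise: `‖curl v‖² ≤ 2 ‖∇v‖²_F` (gen-1, StubBitsV3). -/
theorem norm_curl_sq_le_two_mul_frobeniusNormSq (v : ℝ³ → ℝ³) (y : ℝ³) :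
    ‖curl v y‖ ^ 2 ≤ 2 * frobeniusNormSq (fderiv ℝ v y) := by
  rw [Summit.NavierStokesRegularity.NavierStokesRegularity.Theorems.norm_curl_sq_eq_frobeniusNormSq_sub_trace]
  have htr : LinearMap.trace ℝ ℝ³ ((fderiv ℝ v y : ℝ³ →ₗ[ℝ] ℝ³) ∘ₗ (fderiv ℝ v y : ℝ³ →ₗ[ℝ] ℝ³)) =
      (stdMatrix (fderiv ℝ v y : ℝ³ →ₗ[ℝ] ℝ³) * stdMatrix (fderiv ℝ v y : ℝ³ →ₗ[ℝ] ℝ³)).trace := by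
    rw [← trace_stdMatrix, stdMatrix_comp]
  rw [htr, frobeniusNormSq_eq_sum_sq_stdMatrix]
  set M := stdMatrix (fderiv ℝ v y : ℝ³ →ₗ[ℝ] ℝ³)
  simp only [Matrix.trace, Matrix.diag, Matrix.mul_apply, Fin.sum_univ_three]
  nlinarith [sq_nonneg (M 0 1 + M 1 0), sq_nonneg (M 0 2 + M 2 0), sq_nonneg (M 1 2 + M 2 1),
    sq_nonneg (M 0 0), sq_nonneg (M 1 1), sq_nonneg (M 2 2)]

/-! ## Flux bounds against `φ_R` -/

section Flux

variable (hu : IsTypeIAncientMild C u)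

/-- A continuous function vanishing off `closedBall 0 ρ` is integrable, and its integral is the
integral over the closed ball. -/
theorem integrable_of_continuous_of_eq_zero {f : ℝ³ → ℝ} (hf : Continuous f) {ρ : ℝ}
    (h0 : ∀ y ∉ closedBall (0 : ℝ³) ρ, f y = 0) : Integrable f :=
  hf.integrable_of_hasCompactSupport (HasCompactSupport.intro (isCompact_closedBall _ _) h0)

/-- `∫_{closedBall 0 ρ} k · frob = k · E(ρ)`. -/
theorem setIntegral_closedBall_const_mul_frob (u : ℝ → ℝ³ → ℝ³) (k ρ s : ℝ) :
    ∫ y in closedBall (0 : ℝ³) ρ, k * frobeniusNormSq (fderiv ℝ (lerayOrbit u s) y) =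
      k * ∫ y in ball (0 : ℝ³) ρ, frobeniusNormSq (fderiv ℝ (lerayOrbit u s) y) := by
  rw [integral_const_mul, setIntegral_congr_set (ball_ae_eq_closedBall' ρ)]

include hu in
/-- **Generic collar estimate**: if `|g| ≤ w · frob` pointwise with a continuous weight `w ≥ 0`
vanishing off `closedBall 0 (2R)` and bounded by `m` there, then `|∫ g| ≤ m · E(2R)`. -/
theorem abs_integral_le_of_weight {g w : ℝ³ → ℝ} {R m : ℝ} (s : ℝ) (hw : Continuous w)
    (hw0 : ∀ y ∉ closedBall (0 : ℝ³) (2 * R), w y = 0) (hwm : ∀ y ∈ closedBall (0 : ℝ³) (2 * R), w y ≤ m)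
    (hg : ∀ y, |g y| ≤ w y * frobeniusNormSq (fderiv ℝ (lerayOrbit u s) y)) :
    |∫ y, g y| ≤ m * ∫ y in ball (0 : ℝ³) (2 * R), frobeniusNormSq (fderiv ℝ (lerayOrbit u s) y) := by
  set F : ℝ³ → ℝ := fun y => frobeniusNormSq (fderiv ℝ (lerayOrbit u s) y) with hF
  have hFc : Continuous F := continuous_frobeniusNormSq_fderiv_lerayOrbit hu s
  have hF0 : ∀ y, 0 ≤ F y := fun y => frobeniusNormSq_nonneg _
  -- the majorant `w · F` is integrable (continuous, vanishes off the closed ball)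
  have hG0 : ∀ y ∉ closedBall (0 : ℝ³) (2 * R), w y * F y = 0 := fun y hy => by rw [hw0 y hy, zero_mul]
  have hGi : Integrable fun y => w y * F y := integrable_of_continuous_of_eq_zero (hw.mul hFc) hG0
  have h1 : |∫ y, g y| ≤ ∫ y, w y * F y := by
    have := norm_integral_le_of_norm_le hGi (Eventually.of_forall fun y => by
      rw [Real.norm_eq_abs]; exact hg y)
    simpa only [Real.norm_eq_abs] using this
  have h2 : (∫ y, w y * F y) = ∫ y in closedBall (0 : ℝ³) (2 * R), w y * F y :=
    (setIntegral_eq_integral_of_forall_compl_eq_zero hG0).symm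
  have hmi : IntegrableOn (fun y => m * F y) (closedBall (0 : ℝ³) (2 * R)) :=
    ((continuous_const.mul hFc).continuousOn).integrableOn_compact (isCompact_closedBall _ _)
  have h3 : (∫ y in closedBall (0 : ℝ³) (2 * R), w y * F y) ≤
      ∫ y in closedBall (0 : ℝ³) (2 * R), m * F y :=
    setIntegral_mono_on hGi.integrableOn hmi measurableSet_closedBall fun y hy =>
      mul_le_mul_of_nonneg_right (hwm y hy) (hF0 y)
  rw [setIntegral_closedBall_const_mul_frob u] at h3
  linarith

include hu in
/-- **Cubic (null-Lagrangian) flux**: `|∫ φ_R det DU| ≤ ½ C (c₁/R) E(2R)`. -/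
theorem cubic_flux_le (hUC : ∀ (s : ℝ) (y : ℝ³), ‖lerayOrbit u s y‖ ≤ C) {c₁ : ℝ}
    (hc₁ : ∀ R : ℝ, 0 < R → ∀ y : ℝ³,
      ‖fderiv ℝ (fun z : ℝ³ => smoothTransition (2 - ‖z‖ ^ 2 / R ^ 2)) y‖ ≤ c₁ / R)
    {R : ℝ} (hR : 0 < R) (s : ℝ) :
    |∫ y, smoothTransition (2 - ‖y‖ ^ 2 / R ^ 2) *
        LinearMap.det (fderiv ℝ (lerayOrbit u s) y : ℝ³ →ₗ[ℝ] ℝ³)| ≤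
      (1 / 2) * C * (c₁ / R) * ∫ y in ball (0 : ℝ³) (2 * R), frobeniusNormSq (fderiv ℝ (lerayOrbit u s) y) := by
  have hC : 0 ≤ C := hu.nonneg
  set φ : ℝ³ → ℝ := fun z => smoothTransition (2 - ‖z‖ ^ 2 / R ^ 2) with hφdef
  have hφ : ContDiff ℝ ∞ φ := contDiff_smoothTransition_cutoff (n := ⊤) R
  have hφ1 : ContDiff ℝ 1 φ := contDiff_smoothTransition_cutoff (n := 1) R
  have hφc : HasCompactSupport φ := hasCompactSupport_smoothTransition_cutoff hR
  have hU : ContDiff ℝ ∞ (lerayOrbit u s) := contDiff_lerayOrbit_slice hu s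
  have hUd : ∀ y, DifferentiableAt ℝ (lerayOrbit u s) y := fun y =>
    (contDiff_lerayOrbit_slice hu s (n := 1)).differentiable one_ne_zero y
  rw [show (fun y => smoothTransition (2 - ‖y‖ ^ 2 / R ^ 2) *
      LinearMap.det (fderiv ℝ (lerayOrbit u s) y : ℝ³ →ₗ[ℝ] ℝ³)) = fun y => φ y *
      LinearMap.det (fderiv ℝ (lerayOrbit u s) y : ℝ³ →ₗ[ℝ] ℝ³) from rfl,
    integral_mul_det_fderiv_eq hU hφ hφc, abs_neg]
  -- weight `w = ½ C ‖Dφ‖`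
  refine abs_integral_le_of_weight hu s (w := fun y => (1 / 2) * C * ‖fderiv ℝ φ y‖)
    (continuous_const.mul (hφ1.continuous_fderiv one_ne_zero).norm) (fun y hy => ?_) (fun y _ => ?_)
    (fun y => ?_)
  · show (1 / 2) * C * ‖fderiv ℝ φ y‖ = 0
    rw [hφdef, fderiv_cutoff_eq_zero hR hy, norm_zero, mul_zero]
  · show (1 / 2) * C * ‖fderiv ℝ φ y‖ ≤ (1 / 2) * C * (c₁ / R)
    exact mul_le_mul_of_nonneg_left (hc₁ R hR y) (by positivity)
  · calc |lerayOrbit u s y 0 * ⟪cross (gradient (fun z => lerayOrbit u s z 1) y)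
          (gradient (fun z => lerayOrbit u s z 2) y), gradient φ y⟫|
        ≤ (1 / 2) * ‖lerayOrbit u s y‖ * ‖gradient φ y‖ * frobeniusNormSq (fderiv ℝ (lerayOrbit u s) y) :=
          abs_mul_inner_cross_gradient_le (hUd y) φ
      _ ≤ (1 / 2) * C * ‖fderiv ℝ φ y‖ * frobeniusNormSq (fderiv ℝ (lerayOrbit u s) y) := by
          rw [norm_gradient_eq]
          have hf0 : 0 ≤ frobeniusNormSq (fderiv ℝ (lerayOrbit u s) y) := frobeniusNormSq_nonneg _
          have hn0 : 0 ≤ ‖fderiv ℝ φ y‖ := norm_nonneg _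
          have := hUC s y
          gcongr

include hu in
/-- **Transport flux**: `|∫ (U·∇φ_R) ‖Ω‖²| ≤ 2 C (c₁/R) E(2R)`. -/
theorem transport_flux_le (hUC : ∀ (s : ℝ) (y : ℝ³), ‖lerayOrbit u s y‖ ≤ C) {c₁ : ℝ}
    (hc₁ : ∀ R : ℝ, 0 < R → ∀ y : ℝ³,
      ‖fderiv ℝ (fun z : ℝ³ => smoothTransition (2 - ‖z‖ ^ 2 / R ^ 2)) y‖ ≤ c₁ / R)
    {R : ℝ} (hR : 0 < R) (s : ℝ) :
    |∫ y, fderiv ℝ (fun z : ℝ³ => smoothTransition (2 - ‖z‖ ^ 2 / R ^ 2)) y (lerayOrbit u s y) *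
        ‖lerayVorticity u s y‖ ^ 2| ≤
      2 * C * (c₁ / R) * ∫ y in ball (0 : ℝ³) (2 * R), frobeniusNormSq (fderiv ℝ (lerayOrbit u s) y) := by
  have hC : 0 ≤ C := hu.nonneg
  set φ : ℝ³ → ℝ := fun z => smoothTransition (2 - ‖z‖ ^ 2 / R ^ 2) with hφdef
  have hφ1 : ContDiff ℝ 1 φ := contDiff_smoothTransition_cutoff (n := 1) R
  refine abs_integral_le_of_weight hu s (w := fun y => 2 * C * ‖fderiv ℝ φ y‖)
    (continuous_const.mul (hφ1.continuous_fderiv one_ne_zero).norm) (fun y hy => ?_) (fun y _ => ?_)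
    (fun y => ?_)
  · show 2 * C * ‖fderiv ℝ φ y‖ = 0
    rw [hφdef, fderiv_cutoff_eq_zero hR hy, norm_zero, mul_zero]
  · show 2 * C * ‖fderiv ℝ φ y‖ ≤ 2 * C * (c₁ / R)
    exact mul_le_mul_of_nonneg_left (hc₁ R hR y) (by positivity)
  · have h1 : |fderiv ℝ φ y (lerayOrbit u s y)| ≤ ‖fderiv ℝ φ y‖ * C := by
      rw [← Real.norm_eq_abs]
      exact (ContinuousLinearMap.le_opNorm _ _).trans
        (mul_le_mul_of_nonneg_left (hUC s y) (norm_nonneg _))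
    have h2 : ‖lerayVorticity u s y‖ ^ 2 ≤ 2 * frobeniusNormSq (fderiv ℝ (lerayOrbit u s) y) := by
      rw [lerayVorticity_apply]; exact norm_curl_sq_le_two_mul_frobeniusNormSq _ _
    rw [abs_mul, abs_of_nonneg (sq_nonneg ‖lerayVorticity u s y‖)]
    have hn0 : 0 ≤ ‖fderiv ℝ φ y‖ * C := by positivity
    calc |fderiv ℝ φ y (lerayOrbit u s y)| * ‖lerayVorticity u s y‖ ^ 2
        ≤ (‖fderiv ℝ φ y‖ * C) * (2 * frobeniusNormSq (fderiv ℝ (lerayOrbit u s) y)) :=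
          mul_le_mul h1 h2 (sq_nonneg _) hn0
      _ = 2 * C * ‖fderiv ℝ φ y‖ * frobeniusNormSq (fderiv ℝ (lerayOrbit u s) y) := by ring

include hu in
/-- **Viscous flux**: `|∫ ‖Ω‖² Δφ_R| ≤ 2 (c₂/R²) E(2R)`. -/
theorem viscous_flux_le {c₂ : ℝ}
    (hc₂ : ∀ R : ℝ, 0 < R → ∀ y : ℝ³,
      |(Δ (fun z : ℝ³ => smoothTransition (2 - ‖z‖ ^ 2 / R ^ 2))) y| ≤ c₂ / R ^ 2)
    {R : ℝ} (hR : 0 < R) (s : ℝ) :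
    |∫ y, ‖lerayVorticity u s y‖ ^ 2 * (Δ (fun z : ℝ³ => smoothTransition (2 - ‖z‖ ^ 2 / R ^ 2))) y| ≤
      2 * (c₂ / R ^ 2) * ∫ y in ball (0 : ℝ³) (2 * R), frobeniusNormSq (fderiv ℝ (lerayOrbit u s) y) := by
  set φ : ℝ³ → ℝ := fun z => smoothTransition (2 - ‖z‖ ^ 2 / R ^ 2) with hφdef
  have hφ2 : ContDiff ℝ 2 φ := contDiff_smoothTransition_cutoff (n := 2) R
  refine abs_integral_le_of_weight hu s (w := fun y => 2 * |(Δ φ) y|)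
    (continuous_const.mul (continuous_laplacian hφ2).abs) (fun y hy => ?_) (fun y _ => ?_)
    (fun y => ?_)
  · show 2 * |(Δ φ) y| = 0
    rw [hφdef, laplacian_cutoff_eq_zero hR hy, abs_zero, mul_zero]
  · show 2 * |(Δ φ) y| ≤ 2 * (c₂ / R ^ 2)
    exact mul_le_mul_of_nonneg_left (hc₂ R hR y) zero_le_two
  · have h2 : ‖lerayVorticity u s y‖ ^ 2 ≤ 2 * frobeniusNormSq (fderiv ℝ (lerayOrbit u s) y) := by
      rw [lerayVorticity_apply]; exact norm_curl_sq_le_two_mul_frobeniusNormSq _ _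
    rw [abs_mul, abs_of_nonneg (sq_nonneg ‖lerayVorticity u s y‖)]
    have ha0 : 0 ≤ |(Δ φ) y| := abs_nonneg _
    calc ‖lerayVorticity u s y‖ ^ 2 * |(Δ φ) y|
        ≤ (2 * frobeniusNormSq (fderiv ℝ (lerayOrbit u s) y)) * |(Δ φ) y| :=
          mul_le_mul_of_nonneg_right h2 ha0
      _ = 2 * |(Δ φ) y| * frobeniusNormSq (fderiv ℝ (lerayOrbit u s) y) := by ring

/-- **Drift flux sign**: `∫ (y·∇φ_R) ‖Ω‖² ≤ 0` (ray monotonicity of the cutoff). -/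
theorem drift_flux_nonpos (u : ℝ → ℝ³ → ℝ³) (R s : ℝ) :
    (∫ y, fderiv ℝ (fun z : ℝ³ => smoothTransition (2 - ‖z‖ ^ 2 / R ^ 2)) y y *
        ‖lerayVorticity u s y‖ ^ 2) ≤ 0 :=
  integral_nonpos fun y => mul_nonpos_of_nonpos_of_nonneg
    (fderiv_smoothTransition_cutoff_self_nonpos R y) (sq_nonneg _)

end Flux

/-! ## The integrated production bound -/

/-- **`∫ φ ⟪DU Ω, Ω⟫ ≤ 4 ∫ φ det DU + a (2 ∫ φ ‖DU‖²_F − Z)`** (integrate `production_pointwise`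
against the nonnegative cutoff). -/
theorem production_integral_le (hu : IsTypeIAncientMild C u)
    (hΛ : ∀ t < 0, ∀ x, lerayMiddleStrain u t x ≤ a) (ha : 0 ≤ a) {R : ℝ} (hR : 0 < R) (s : ℝ) :
    (∫ y, smoothTransition (2 - ‖y‖ ^ 2 / R ^ 2) *
        ⟪fderiv ℝ (lerayOrbit u s) y (lerayVorticity u s y), lerayVorticity u s y⟫) ≤
      4 * (∫ y, smoothTransition (2 - ‖y‖ ^ 2 / R ^ 2) *
          LinearMap.det (fderiv ℝ (lerayOrbit u s) y : ℝ³ →ₗ[ℝ] ℝ³)) +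
        a * (2 * (∫ y, smoothTransition (2 - ‖y‖ ^ 2 / R ^ 2) * frobeniusNormSq (fderiv ℝ (lerayOrbit u s) y)) -
          ∫ y, smoothTransition (2 - ‖y‖ ^ 2 / R ^ 2) * ‖lerayVorticity u s y‖ ^ 2) := by
  set φ : ℝ³ → ℝ := fun z => smoothTransition (2 - ‖z‖ ^ 2 / R ^ 2) with hφdef
  have hφc : HasCompactSupport φ := hasCompactSupport_smoothTransition_cutoff hR
  have hφcont : Continuous φ := (contDiff_smoothTransition_cutoff (n := 0) R).continuous
  have hφ0 : ∀ y, 0 ≤ φ y := fun y => smoothTransition_cutoff_nonneg R y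
  have hcDU : Continuous (fderiv ℝ (lerayOrbit u s)) :=
    (contDiff_lerayOrbit_slice hu s (n := 1)).continuous_fderiv one_ne_zero
  have hcΩ : Continuous (lerayVorticity u s) := continuous_lerayVorticity hu s
  have hcF : Continuous fun y => frobeniusNormSq (fderiv ℝ (lerayOrbit u s) y) :=
    continuous_frobeniusNormSq_fderiv_lerayOrbit hu s
  have hcdet : Continuous fun y => LinearMap.det (fderiv ℝ (lerayOrbit u s) y : ℝ³ →ₗ[ℝ] ℝ³) :=
    ContinuousLinearMap.continuous_det.comp hcDU
  have hcP : Continuous fun y => ⟪fderiv ℝ (lerayOrbit u s) y (lerayVorticity u s y), lerayVorticity u s y⟫ :=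
    (hcDU.clm_apply hcΩ).inner hcΩ
  -- integrability (continuous × compactly supported cutoff)
  have iP : Integrable fun y => φ y * ⟪fderiv ℝ (lerayOrbit u s) y (lerayVorticity u s y), lerayVorticity u s y⟫ :=
    (hφcont.mul hcP).integrable_of_hasCompactSupport hφc.mul_right
  have idet : Integrable fun y => φ y * LinearMap.det (fderiv ℝ (lerayOrbit u s) y : ℝ³ →ₗ[ℝ] ℝ³) :=
    (hφcont.mul hcdet).integrable_of_hasCompactSupport hφc.mul_right
  have iF : Integrable fun y => φ y * frobeniusNormSq (fderiv ℝ (lerayOrbit u s) y) :=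
    (hφcont.mul hcF).integrable_of_hasCompactSupport hφc.mul_right
  have iZ : Integrable fun y => φ y * ‖lerayVorticity u s y‖ ^ 2 :=
    (hφcont.mul (hcΩ.norm.pow 2)).integrable_of_hasCompactSupport hφc.mul_right
  have iG : Integrable fun y => 4 * (φ y * LinearMap.det (fderiv ℝ (lerayOrbit u s) y : ℝ³ →ₗ[ℝ] ℝ³)) +
      a * (2 * (φ y * frobeniusNormSq (fderiv ℝ (lerayOrbit u s) y)) - φ y * ‖lerayVorticity u s y‖ ^ 2) :=
    (idet.const_mul 4).add (((iF.const_mul 2).sub iZ).const_mul a)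
  -- pointwise
  have hpt : ∀ y, φ y * ⟪fderiv ℝ (lerayOrbit u s) y (lerayVorticity u s y), lerayVorticity u s y⟫ ≤
      4 * (φ y * LinearMap.det (fderiv ℝ (lerayOrbit u s) y : ℝ³ →ₗ[ℝ] ℝ³)) +
        a * (2 * (φ y * frobeniusNormSq (fderiv ℝ (lerayOrbit u s) y)) - φ y * ‖lerayVorticity u s y‖ ^ 2) := by
    intro y
    have h := mul_le_mul_of_nonneg_left (production_pointwise hu hΛ ha s y) (hφ0 y)
    have e : φ y * (4 * LinearMap.det (fderiv ℝ (lerayOrbit u s) y : ℝ³ →ₗ[ℝ] ℝ³) +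
        a * (2 * frobeniusNormSq (fderiv ℝ (lerayOrbit u s) y) - ‖lerayVorticity u s y‖ ^ 2)) =
        4 * (φ y * LinearMap.det (fderiv ℝ (lerayOrbit u s) y : ℝ³ →ₗ[ℝ] ℝ³)) +
          a * (2 * (φ y * frobeniusNormSq (fderiv ℝ (lerayOrbit u s) y)) - φ y * ‖lerayVorticity u s y‖ ^ 2) := by
      ring
    rw [e] at h
    exact h
  have hmono := integral_mono iP iG hpt
  have i1 : Integrable fun y => 4 * (φ y * LinearMap.det (fderiv ℝ (lerayOrbit u s) y : ℝ³ →ₗ[ℝ] ℝ³)) :=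
    idet.const_mul 4
  have i23 : Integrable fun y => 2 * (φ y * frobeniusNormSq (fderiv ℝ (lerayOrbit u s) y)) -
      φ y * ‖lerayVorticity u s y‖ ^ 2 := (iF.const_mul 2).sub iZ
  have i2 : Integrable fun y => a * (2 * (φ y * frobeniusNormSq (fderiv ℝ (lerayOrbit u s) y)) -
      φ y * ‖lerayVorticity u s y‖ ^ 2) := i23.const_mul a
  have eA : (∫ y, 4 * (φ y * LinearMap.det (fderiv ℝ (lerayOrbit u s) y : ℝ³ →ₗ[ℝ] ℝ³)) +
      a * (2 * (φ y * frobeniusNormSq (fderiv ℝ (lerayOrbit u s) y)) - φ y * ‖lerayVorticity u s y‖ ^ 2)) =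
      (∫ y, 4 * (φ y * LinearMap.det (fderiv ℝ (lerayOrbit u s) y : ℝ³ →ₗ[ℝ] ℝ³))) +
        ∫ y, a * (2 * (φ y * frobeniusNormSq (fderiv ℝ (lerayOrbit u s) y)) - φ y * ‖lerayVorticity u s y‖ ^ 2) :=
    integral_add i1 i2
  have eB : (∫ y, 4 * (φ y * LinearMap.det (fderiv ℝ (lerayOrbit u s) y : ℝ³ →ₗ[ℝ] ℝ³))) =
      4 * ∫ y, φ y * LinearMap.det (fderiv ℝ (lerayOrbit u s) y : ℝ³ →ₗ[ℝ] ℝ³) :=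
    integral_const_mul _ _
  have eC : (∫ y, a * (2 * (φ y * frobeniusNormSq (fderiv ℝ (lerayOrbit u s) y)) - φ y * ‖lerayVorticity u s y‖ ^ 2)) =
      a * ∫ y, (2 * (φ y * frobeniusNormSq (fderiv ℝ (lerayOrbit u s) y)) - φ y * ‖lerayVorticity u s y‖ ^ 2) :=
    integral_const_mul _ _
  have eD : (∫ y, (2 * (φ y * frobeniusNormSq (fderiv ℝ (lerayOrbit u s) y)) - φ y * ‖lerayVorticity u s y‖ ^ 2)) =
      (∫ y, 2 * (φ y * frobeniusNormSq (fderiv ℝ (lerayOrbit u s) y))) - ∫ y, φ y * ‖lerayVorticity u s y‖ ^ 2 :=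
    integral_sub (iF.const_mul 2) iZ
  have eE : (∫ y, 2 * (φ y * frobeniusNormSq (fderiv ℝ (lerayOrbit u s) y))) =
      2 * ∫ y, φ y * frobeniusNormSq (fderiv ℝ (lerayOrbit u s) y) :=
    integral_const_mul _ _
  have hsum : (∫ y, 4 * (φ y * LinearMap.det (fderiv ℝ (lerayOrbit u s) y : ℝ³ →ₗ[ℝ] ℝ³)) +
      a * (2 * (φ y * frobeniusNormSq (fderiv ℝ (lerayOrbit u s) y)) - φ y * ‖lerayVorticity u s y‖ ^ 2)) =
      4 * (∫ y, φ y * LinearMap.det (fderiv ℝ (lerayOrbit u s) y : ℝ³ →ₗ[ℝ] ℝ³)) +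
        a * (2 * (∫ y, φ y * frobeniusNormSq (fderiv ℝ (lerayOrbit u s) y)) -
          ∫ y, φ y * ‖lerayVorticity u s y‖ ^ 2) := by
    rw [eA, eB, eC, eD, eE]
  rw [hsum] at hmono
  exact hmono

/-! ## Assembly: the static half of `stub_signedBudget` -/

/-- **The lever without the time derivative.**  For `R ≥ 1` put
`K s := κ₀ E(2R,s)/R + 4aκ'⁺ √(E(2R,s)/R)`, `κ₀ = 6 C c₁ + 2 c₂`.  Then `K` is continuous,
nonnegative, `K ≤ κ (E/R + √(E/R))` with `κ = max κ₀ (4aκ'⁺)`, and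
`−½Z + ½∫(y·∇φ)‖Ω‖² + ∫(U·∇φ)‖Ω‖² + 2∫φ⟪DUΩ,Ω⟫ + ∫‖Ω‖²Δφ ≤ −2(¼ − a) Z + K`.
The left side is `Z' + 2∫φ‖∇Ω‖²_F` by the similarity vorticity equation and the three
`WholeSpaceIBPEnstrophy` identities (the lead's remaining step). -/
theorem lever_static_bound (C a κ' : ℝ) (u : ℝ → ℝ³ → ℝ³) (hu : IsTypeIAncientMild C u)
    (hΛ : ∀ t < 0, ∀ x, lerayMiddleStrain u t x ≤ a) (ha : 0 ≤ a)
    (hUC : ∀ (s : ℝ) (y : ℝ³), ‖lerayOrbit u s y‖ ≤ C)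
    (hEcont : ∀ ρ : ℝ, 0 < ρ →
      Continuous fun s => ∫ y in Metric.ball (0 : ℝ³) ρ, frobeniusNormSq (fderiv ℝ (lerayOrbit u s) y))
    (hcmp : ∀ (R s : ℝ), 1 ≤ R →
      (∫ y, smoothTransition (2 - ‖y‖ ^ 2 / R ^ 2) * frobeniusNormSq (fderiv ℝ (lerayOrbit u s) y)) ≤
        (∫ y, smoothTransition (2 - ‖y‖ ^ 2 / R ^ 2) * ‖lerayVorticity u s y‖ ^ 2) +
          κ' * Real.sqrt ((∫ y in Metric.ball (0 : ℝ³) (2 * R),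
            frobeniusNormSq (fderiv ℝ (lerayOrbit u s) y)) / R)) :
    ∃ κ : ℝ, ∀ R : ℝ, 1 ≤ R →
      ∃ K : ℝ → ℝ, Continuous K ∧ (∀ s, 0 ≤ K s) ∧
        (∀ s, K s ≤ κ * ((∫ y in Metric.ball (0 : ℝ³) (2 * R), frobeniusNormSq (fderiv ℝ (lerayOrbit u s) y)) / R +
          Real.sqrt ((∫ y in Metric.ball (0 : ℝ³) (2 * R), frobeniusNormSq (fderiv ℝ (lerayOrbit u s) y)) / R))) ∧
        ∀ s, -(1 / 2) * (∫ y, smoothTransition (2 - ‖y‖ ^ 2 / R ^ 2) * ‖lerayVorticity u s y‖ ^ 2)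
            + (1 / 2) * (∫ y, fderiv ℝ (fun z : ℝ³ => smoothTransition (2 - ‖z‖ ^ 2 / R ^ 2)) y y *
                ‖lerayVorticity u s y‖ ^ 2)
            + (∫ y, fderiv ℝ (fun z : ℝ³ => smoothTransition (2 - ‖z‖ ^ 2 / R ^ 2)) y (lerayOrbit u s y) *
                ‖lerayVorticity u s y‖ ^ 2)
            + 2 * (∫ y, smoothTransition (2 - ‖y‖ ^ 2 / R ^ 2) *
                ⟪fderiv ℝ (lerayOrbit u s) y (lerayVorticity u s y), lerayVorticity u s y⟫)
            + (∫ y, ‖lerayVorticity u s y‖ ^ 2 *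
                (Δ (fun z : ℝ³ => smoothTransition (2 - ‖z‖ ^ 2 / R ^ 2))) y)
          ≤ -(2 * (1 / 4 - a)) * (∫ y, smoothTransition (2 - ‖y‖ ^ 2 / R ^ 2) * ‖lerayVorticity u s y‖ ^ 2)
              + K s := by
  obtain ⟨c₁, hc₁0, hc₁⟩ := exists_norm_fderiv_smoothTransition_cutoff_le (E := ℝ³)
  obtain ⟨c₂, hc₂0, hc₂⟩ := exists_abs_laplacian_smoothTransition_cutoff_le (E := ℝ³)
  have hC : 0 ≤ C := hu.nonneg
  have hk0 : 0 ≤ max κ' 0 := le_max_right _ _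
  refine ⟨max (6 * C * c₁ + 2 * c₂) (4 * a * max κ' 0), fun R hR1 => ?_⟩
  have hR : 0 < R := lt_of_lt_of_le one_pos hR1
  -- the forcing
  refine ⟨fun s => (6 * C * c₁ + 2 * c₂) *
      ((∫ y in Metric.ball (0 : ℝ³) (2 * R), frobeniusNormSq (fderiv ℝ (lerayOrbit u s) y)) / R) +
      4 * a * max κ' 0 *
        Real.sqrt ((∫ y in Metric.ball (0 : ℝ³) (2 * R), frobeniusNormSq (fderiv ℝ (lerayOrbit u s) y)) / R),
    ?_, ?_, ?_, ?_⟩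
  · -- continuity
    have hE := hEcont (2 * R) (by positivity)
    exact ((hE.div_const R).const_mul _).add ((hE.div_const R).sqrt.const_mul _)
  · -- nonnegativity
    intro s
    have hE0 := ballGradEnergy_nonneg u (2 * R) s
    positivity
  · -- comparison with `κ (E/R + √(E/R))`
    intro s
    set X : ℝ := (∫ y in Metric.ball (0 : ℝ³) (2 * R), frobeniusNormSq (fderiv ℝ (lerayOrbit u s) y)) / R
    have hX : 0 ≤ X := div_nonneg (ballGradEnergy_nonneg u (2 * R) s) hR.le
    have hS : 0 ≤ Real.sqrt X := Real.sqrt_nonneg _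
    rw [mul_add]
    exact add_le_add (mul_le_mul_of_nonneg_right (le_max_left _ _) hX)
      (mul_le_mul_of_nonneg_right (le_max_right _ _) hS)
  · -- the inequality
    intro s
    beta_reduce
    set Z : ℝ := ∫ y, smoothTransition (2 - ‖y‖ ^ 2 / R ^ 2) * ‖lerayVorticity u s y‖ ^ 2 with hZ
    set E2 : ℝ := ∫ y in Metric.ball (0 : ℝ³) (2 * R), frobeniusNormSq (fderiv ℝ (lerayOrbit u s) y) with hE2
    set Idet : ℝ := ∫ y, smoothTransition (2 - ‖y‖ ^ 2 / R ^ 2) *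
        LinearMap.det (fderiv ℝ (lerayOrbit u s) y : ℝ³ →ₗ[ℝ] ℝ³) with hIdet
    set Ifrob : ℝ := ∫ y, smoothTransition (2 - ‖y‖ ^ 2 / R ^ 2) *
        frobeniusNormSq (fderiv ℝ (lerayOrbit u s) y) with hIfrob
    set P : ℝ := ∫ y, smoothTransition (2 - ‖y‖ ^ 2 / R ^ 2) *
        ⟪fderiv ℝ (lerayOrbit u s) y (lerayVorticity u s y), lerayVorticity u s y⟫ with hP
    set D : ℝ := ∫ y, fderiv ℝ (fun z : ℝ³ => smoothTransition (2 - ‖z‖ ^ 2 / R ^ 2)) y y *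
        ‖lerayVorticity u s y‖ ^ 2 with hD
    set T : ℝ := ∫ y, fderiv ℝ (fun z : ℝ³ => smoothTransition (2 - ‖z‖ ^ 2 / R ^ 2)) y (lerayOrbit u s y) *
        ‖lerayVorticity u s y‖ ^ 2 with hT
    set V : ℝ := ∫ y, ‖lerayVorticity u s y‖ ^ 2 *
        (Δ (fun z : ℝ³ => smoothTransition (2 - ‖z‖ ^ 2 / R ^ 2))) y with hV
    set S : ℝ := Real.sqrt (E2 / R) with hS
    have hE0 : 0 ≤ E2 := ballGradEnergy_nonneg u (2 * R) s
    have hX0 : 0 ≤ E2 / R := div_nonneg hE0 hR.le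
    have hS0 : 0 ≤ S := Real.sqrt_nonneg _
    -- the five estimates
    have h1 : Idet ≤ (1 / 2) * (C * c₁ * (E2 / R)) := by
      have h := (abs_le.1 (cubic_flux_le hu hUC hc₁ hR s)).2
      have e : (1 / 2) * C * (c₁ / R) * E2 = (1 / 2) * (C * c₁ * (E2 / R)) := by ring
      linarith
    have h2 : T ≤ 2 * (C * c₁ * (E2 / R)) := by
      have h := (abs_le.1 (transport_flux_le hu hUC hc₁ hR s)).2
      have e : 2 * C * (c₁ / R) * E2 = 2 * (C * c₁ * (E2 / R)) := by ring
      linarith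
    have h3 : V ≤ 2 * (c₂ * (E2 / R)) := by
      have h := (abs_le.1 (viscous_flux_le hu hc₂ hR s)).2
      have hRR : c₂ / R ^ 2 ≤ c₂ / R :=
        div_le_div_of_nonneg_left hc₂0 hR (by nlinarith)
      have e : 2 * (c₂ / R) * E2 = 2 * (c₂ * (E2 / R)) := by ring
      nlinarith
    have h4 : D ≤ 0 := drift_flux_nonpos u R s
    have h5 : P ≤ 4 * Idet + 2 * (a * Ifrob) - a * Z := by
      have h := production_integral_le hu hΛ ha hR s
      have e : a * (2 * Ifrob - Z) = 2 * (a * Ifrob) - a * Z := by ring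
      linarith
    have h6 : a * Ifrob ≤ a * Z + a * (max κ' 0 * S) := by
      have hc := hcmp R s hR1
      have hκ : κ' * S ≤ max κ' 0 * S := mul_le_mul_of_nonneg_right (le_max_left _ _) hS0
      have hI : Ifrob ≤ Z + max κ' 0 * S := by linarith
      have h := mul_le_mul_of_nonneg_left hI ha
      have e : a * (Z + max κ' 0 * S) = a * Z + a * (max κ' 0 * S) := by ring
      linarith
    -- normalise the target and close linearly
    have eZ : -(2 * (1 / 4 - a)) * Z = -(1 / 2) * Z + 2 * (a * Z) := by ring
    have eK : (6 * C * c₁ + 2 * c₂) * (E2 / R) + 4 * a * max κ' 0 * S =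
        6 * (C * c₁ * (E2 / R)) + 2 * (c₂ * (E2 / R)) + 4 * (a * (max κ' 0 * S)) := by ring
    rw [eZ, eK]
    linarith

end DrefuteG2
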